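import Summits.HubbardSuperconductivity.HubbardSuperconductivity.Theorems.KLProgrammeKLRegimeScaleZeroCovarianceFarSiteHighShellSum
import Summits.HubbardSuperconductivity.HubbardSuperconductivity.Theorems.KLProgrammeKLRegimeFlowReadScaleZeroSunsetFarRowsL2
import Summits.HubbardSuperconductivity.HubbardSuperconductivity.Theorems.KLProgrammeKLRegimeFlowReadScaleZeroSunsetCertRows

/-!
# Route `KLProgramme`, crux K3 — engine-flow child (stmt-HubbardSuperconductivity-20437), stub (C) at `n = 0`, located item #22a «(C)-SCALE0-PT2»:
# THE CERTIFIED SUNSET ROWS, TWO-SHELLS FORM — near record V3 + (high shell by name) + ONE low-shell far-ℓ² envelope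

Seat hubbard-kl-k3c5-p1 (g14; owner of #22a).  Design of record (R215): the far rows come from the per-frequency weighted far ℓ² of the spatial symbol's torus
Fourier inverse (`farRows_le_of_l2Far`); the HIGH shell `|ω_i| ≥ ω₁ ≥ klE0` is closed by name (`sum_l2Far_high_le`, certificate-free); the LOW shell `|ω_i| < ω₁`
is the kit's Plancherel-complement certificate, which delivers ONE number per row: `farℓ²_k(ω) ≤ Dlow k` for `|ω| < ω₁`.  This file composes everything:
* §1 `sum_l2Far_low_le` — the low-shell window sum without counting frequencies: `Σ_{i : |ω_i| < ω₁} Dlow ≤ β·ω₁·Dlow` (since `1 = ω₁²/max(|ω_i|,ω₁)²` there and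
  `Σ_i 1/max(|ω_i|,ω₁)² ≤ β/ω₁`);
* §2 **`sunsetRows_of_certV3_twoShells`** — the hypotheses `hS0`/`hSk` of `twoLegRead_frameZero_of_sunsetData`, literally, from: `ScaleZeroSunsetCertV3 c` (near), the
  low-shell envelope `hlow` (the only far certificate input), `μ ∈ klWindowC ∩ cell`, `klBetaMin ≤ β`, `L ≥ klEngL₃ β U`, `β/4M ≤ 2⁻¹⁰`, the torus-tail parameters and
  tail smallness `hT` of the near reader, `0 ≤ row k`, the crossover `klE0 ≤ ω₁` with `e^{−arsinh(ω₁/4)L/2} ≤ 1/2`, and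
  `bS k ≥ row k + 16·(2ᵏ·2500·C(ω₁,Rc)/ω₁ + ω₁·Dlow k)`, `C(ω₁,Rc) = max(1,2k/κ₁)ᵏ·e^{−κ₁(Rc+1)}·(1+2/(1−e^{−κ₁/4}))²`, `κ₁ = arsinh(ω₁/4)`.

No definitions; nothing here asserts (C), any stub of 20437, K3 or superconductivity.
References: BGM 2006 §2.2–§2.3, §3 (3.2) [cite: BenfattoGiulianiMastropietro2006].
-/

noncomputable section

namespace Summit.HubbardSuperconductivity.HubbardSuperconductivity.Theorems.KLRegimeSplit

set_option linter.dupNamespace false -- summit = problem name (single-conjunct summit), D-0017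

open Literature.MathematicalPhysics.QuantumLattice Literature.Probability.LatticeModels Literature.Analysis.FunctionSpaces
open Summit.HubbardSuperconductivity.HubbardSuperconductivity.Theorems.DispersionFlow
open Summit.HubbardSuperconductivity.HubbardSuperconductivity.Theorems.EngineV8
open MeasureTheory Set Finset Complex UnitAddTorus Real GrassmannAlgebra Matrix
open scoped FourierTransform Nat ENNReal NNReal

variable {L M : ℕ} [NeZero L]

/-! ## §1 The low-shell window sum -/

omit [NeZero L] in
/-- **Low-shell window sum**: for `0 < β`, `0 < ω₁`, `0 ≤ D`: `Σ_i (if |ω_i| < ω₁ then D else 0) ≤ β·ω₁·D` — no frequency counting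
(`1 ≤ ω₁²/max(|ω_i|,ω₁)²` on the low shell and `Σ_i 1/max(|ω_i|,ω₁)² ≤ β/ω₁`). -/
theorem sum_l2Far_low_le {β ω₁ D : ℝ} (hβ : 0 < β) (hω₁ : 0 < ω₁) (hD : 0 ≤ D) (M : ℕ) :
    ∑ i : MatsubaraIdx M, (if |matsubaraFreq β M i| < ω₁ then D else 0) ≤ β * ω₁ * D := by
  have hle : ∀ i : MatsubaraIdx M, (if |matsubaraFreq β M i| < ω₁ then D else 0) ≤ (D * ω₁ ^ 2) * (1 / max |matsubaraFreq β M i| ω₁ ^ 2) := by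
    intro i
    split_ifs with h
    · rw [max_eq_right h.le]
      field_simp
      exact le_rfl
    · positivity
  refine (Finset.sum_le_sum fun i _ => hle i).trans ?_
  rw [← Finset.mul_sum]
  calc D * ω₁ ^ 2 * ∑ i : MatsubaraIdx M, 1 / max |matsubaraFreq β M i| ω₁ ^ 2 ≤ D * ω₁ ^ 2 * (β / ω₁) :=
        mul_le_mul_of_nonneg_left (sum_inv_max_sq_matsubaraIdx_le hβ hω₁ M) (by positivity)
    _ = β * ω₁ * D := by field_simp

/-! ## §2 The certified rows, two-shells form -/

/-- **THE CERTIFIED SUNSET ROWS `hS0` / `hSk` — TWO-SHELLS FORM** (near: `ScaleZeroSunsetCertV3 c`; far high shell by name; far low shell: ONE envelope number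
`Dlow k` bounding the weighted far ℓ² of the torus Fourier inverse of the spatial symbol at every window frequency `|ω_i| < ω₁` — the Plancherel-complement
certificate's output). -/
theorem sunsetRows_of_certV3_twoShells [NeZero M] (c : SunsetCellRecordV3) (hc : ScaleZeroSunsetCertV3 c)
    {μ U β : ℝ} (hμ : μ ∈ klWindowC) (hμlo : (c.μlo : ℝ) ≤ μ) (hμhi : μ ≤ c.μhi)
    (hβ : klBetaMin ≤ β) (hL : klEngL₃ β U ≤ L) (hδ : β / ((2 * (2 * M) : ℕ) : ℝ) ≤ (2 : ℝ)⁻¹ ^ 10)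
    {N' R : ℕ} (hN' : 2 * 2 ≤ N') (hR : R + 1 + 2 * c.Rc ≤ L)
    (hT : ENNReal.ofReal (β / klBetaMin) *
        ENNReal.ofReal ((19 / 3) * (4 + |μ| + (0 : TrigPolyC4v).coeffNorm 0) * β / (2 * π ^ 2 * M) +
            (N' ! * klChi2CauchyTab N' * (N' + 1) ! * 4 * (max 1 (4 / klE0)) ^ (N' - 1) * ((2 * π) * 4) ^ N') * (2 / klE0) *
              (1 / (2 * Real.pi) ^ N' * (2 / ((2 * R + 2 : ℕ) : ℝ)) ^ (N' - 2 * 2) * (2 ^ 2 * ∑' k : Site 2, ∏ j, (1 + (k j : ℝ) ^ 2)⁻¹))) ≤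
      ENNReal.ofReal (c.Tmax : ℝ))
    (hrow : ∀ k : Fin 3, 0 ≤ (c.row k : ℝ))
    {ω₁ : ℝ} (hω₁ : klE0 ≤ ω₁) (hρ : Real.exp (-(Real.arsinh (ω₁ / 4) * L / 2)) ≤ 1 / 2)
    {Dlow : Fin 3 → ℝ} (hDlow : ∀ k : Fin 3, 0 ≤ Dlow k)
    (hlow : ∀ (k : Fin 3) (i : MatsubaraIdx M), |matsubaraFreq β M i| < ω₁ →
      ∑ u : TorusSite 2 L,
        (if u ≠ 0 ∧ (fun j => (u j).valMinAbs : Site 2) ∉ c.disk then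
          Real.sqrt ((((u 0).valMinAbs.natAbs : ℝ)) ^ 2 + (((u 1).valMinAbs.natAbs : ℝ)) ^ 2) ^ (k : ℕ) *
            ‖torusFourierInv (fun kv : TorusSite 2 L =>
              (fun y : Momentum => uvSymbolFn 1 klE0 (frameLevel μ 0 ((2 * π) • y)) (matsubaraFreq β M i))
                (WithLp.toLp 2 fun j => ((kv j).val : ℝ) / L)) u‖ ^ 2
          else 0) ≤ Dlow k)
    {bS : ℕ → ℝ}
    (hbS : ∀ k : Fin 3, (c.row k : ℝ) + 16 * (2 ^ (k : ℕ) * 2500 *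
        ((max 1 ((2 * (k : ℕ) : ℝ) / Real.arsinh (ω₁ / 4))) ^ (k : ℕ) * Real.exp (-(Real.arsinh (ω₁ / 4) * (c.Rc + 1))) *
          (1 + 2 * (1 - Real.exp (-(Real.arsinh (ω₁ / 4) / 4)))⁻¹) ^ 2) / ω₁ + ω₁ * Dlow k) ≤ bS k) :
    (∀ (σ : Fin 2) (p₀ : GridPoint L (2 * (2 * M))), ∑ p₁ : GridPoint L (2 * (2 * M)),
      (if p₁ = p₀ then (0 : ℝ) else (if p₁.2 - p₀.2 = 0 then (0 : ℝ) else 1) * ‖contr ℂ ((hubbardGridSub L M β (2 * (2 * M))).transpose * hubbardCovAboveCT L M β μ 0 0 klE0 *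
                hubbardGridSub L M β (2 * (2 * M))) (((p₁, σ), 0) : GridLeg (GridPoint L (2 * (2 * M)))) ((p₀, σ), 1) *
              (contr ℂ ((hubbardGridSub L M β (2 * (2 * M))).transpose * hubbardCovAboveCT L M β μ 0 0 klE0 *
                hubbardGridSub L M β (2 * (2 * M))) (((p₀, σ.rev), 0) : GridLeg (GridPoint L (2 * (2 * M)))) ((p₁, σ.rev), 1) *
                contr ℂ ((hubbardGridSub L M β (2 * (2 * M))).transpose * hubbardCovAboveCT L M β μ 0 0 klE0 *
                hubbardGridSub L M β (2 * (2 * M))) (((p₁, σ.rev), 0) : GridLeg (GridPoint L (2 * (2 * M)))) ((p₀, σ.rev), 1))‖) ≤ bS 0 * (((2 * (2 * M) : ℕ) : ℝ) / β)) ∧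
    (∀ k, 1 ≤ k → k ≤ 2 → ∀ (σ : Fin 2) (p₀ : GridPoint L (2 * (2 * M))), ∑ p₁ : GridPoint L (2 * (2 * M)),
      (if p₁ = p₀ then (0 : ℝ) else
        Real.sqrt ((((p₁.2 - p₀.2) 0).valMinAbs.natAbs : ℝ) ^ 2 + (((p₁.2 - p₀.2) 1).valMinAbs.natAbs : ℝ) ^ 2) ^ k * ‖contr ℂ ((hubbardGridSub L M β (2 * (2 * M))).transpose * hubbardCovAboveCT L M β μ 0 0 klE0 *
                hubbardGridSub L M β (2 * (2 * M))) (((p₁, σ), 0) : GridLeg (GridPoint L (2 * (2 * M)))) ((p₀, σ), 1) *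
              (contr ℂ ((hubbardGridSub L M β (2 * (2 * M))).transpose * hubbardCovAboveCT L M β μ 0 0 klE0 *
                hubbardGridSub L M β (2 * (2 * M))) (((p₀, σ.rev), 0) : GridLeg (GridPoint L (2 * (2 * M)))) ((p₁, σ.rev), 1) *
                contr ℂ ((hubbardGridSub L M β (2 * (2 * M))).transpose * hubbardCovAboveCT L M β μ 0 0 klE0 *
                hubbardGridSub L M β (2 * (2 * M))) (((p₁, σ.rev), 0) : GridLeg (GridPoint L (2 * (2 * M)))) ((p₀, σ.rev), 1))‖) ≤
        bS k * (((2 * (2 * M) : ℕ) : ℝ) / β)) := by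
  classical
  have hβ₀ : (0 : ℝ) < klBetaMin := by norm_num [klBetaMin]
  have hβpos : 0 < β := lt_of_lt_of_le hβ₀ hβ
  have hE0 : (0 : ℝ) < klE0 := by norm_num [klE0]
  have hω₁0 : 0 < ω₁ := lt_of_lt_of_le hE0 hω₁
  -- high-shell constant per row
  set Ch : Fin 3 → ℝ := fun k => 2 ^ (k : ℕ) * 2500 *
    ((max 1 ((2 * (k : ℕ) : ℝ) / Real.arsinh (ω₁ / 4))) ^ (k : ℕ) * Real.exp (-(Real.arsinh (ω₁ / 4) * (c.Rc + 1))) *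
      (1 + 2 * (1 - Real.exp (-(Real.arsinh (ω₁ / 4) / 4)))⁻¹) ^ 2) / ω₁ with hCh
  -- the per-frequency family: high shell by the strip, low shell by the envelope
  set farL2 : Fin 3 → MatsubaraIdx M → ℝ := fun k i => ∑ u : TorusSite 2 L,
      (if u ≠ 0 ∧ (fun j => (u j).valMinAbs : Site 2) ∉ c.disk then
        Real.sqrt ((((u 0).valMinAbs.natAbs : ℝ)) ^ 2 + (((u 1).valMinAbs.natAbs : ℝ)) ^ 2) ^ (k : ℕ) *
          ‖torusFourierInv (fun kv : TorusSite 2 L =>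
            (fun y : Momentum => uvSymbolFn 1 klE0 (frameLevel μ 0 ((2 * π) • y)) (matsubaraFreq β M i))
              (WithLp.toLp 2 fun j => ((kv j).val : ℝ) / L)) u‖ ^ 2
        else 0) with hfarL2
  have hsplit : ∀ (k : Fin 3) (i : MatsubaraIdx M), farL2 k i ≤
      (if ω₁ ≤ |matsubaraFreq β M i| then farL2 k i else 0) + (if |matsubaraFreq β M i| < ω₁ then Dlow k else 0) := by
    intro k i
    by_cases h : ω₁ ≤ |matsubaraFreq β M i|
    · rw [if_pos h, if_neg (not_lt.2 h), add_zero]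
    · rw [if_neg h, if_pos (not_le.1 h), zero_add]
      exact hlow k i (not_le.1 h)
  -- the window sum of the family
  have hΦsum : ∀ k : Fin 3, (1 / β) * ∑ i : MatsubaraIdx M, farL2 k i ≤ Ch k + ω₁ * Dlow k := by
    intro k
    have hhigh := sum_l2Far_high_le (L := L) c.toSunsetCellRecordV2 μ hβpos hω₁ hρ M k
    have hlow' := sum_l2Far_low_le hβpos hω₁0 (hDlow k) M
    have h1 : ∑ i : MatsubaraIdx M, farL2 k i ≤ β * Ch k + β * ω₁ * Dlow k := by
      refine (Finset.sum_le_sum fun i _ => hsplit k i).trans ?_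
      rw [Finset.sum_add_distrib]
      refine add_le_add (le_trans (le_of_eq rfl) (hhigh.trans (le_of_eq ?_))) hlow'
      simp only [hCh]
    rw [one_div, inv_mul_le_iff₀ hβpos]
    linarith
  -- the far rows through the interface
  have hfar : ∀ (k : Fin 3) (σ : Fin 2) (p₀ : GridPoint L (2 * (2 * M))), _ :=
    fun k σ p₀ => farRows_le_of_l2Far (L := L) (M := M) c.toSunsetCellRecordV2 hμ hβ hL k (Φ := farL2 k) (fun i => le_rfl) σ p₀
  refine sunsetRows_of_certV3 c hc hμlo hμhi hβ hδ hN' hR hT hrow (bFar := fun k => 16 * (if hk : k < 3 then Ch ⟨k, hk⟩ + ω₁ * Dlow ⟨k, hk⟩ else 0))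
    (fun k σ p₀ => ?_) (fun k => ?_)
  · -- far row k ≤ 16·(Ch + ω₁ Dlow)·(4M/β)
    have h := hfar k σ p₀
    refine h.trans ?_
    have hk : (k : ℕ) < 3 := k.isLt
    have hN : 0 ≤ (((2 * (2 * M) : ℕ) : ℝ) / β) := by positivity
    have hkey : 16 * ((1 / β) * ∑ i : MatsubaraIdx M, farL2 k i) ≤ 16 * (if hk' : (k : ℕ) < 3 then Ch ⟨k, hk'⟩ + ω₁ * Dlow ⟨k, hk'⟩ else 0) := by
      rw [dif_pos hk]
      exact mul_le_mul_of_nonneg_left (hΦsum k) (by norm_num)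
    exact mul_le_mul_of_nonneg_right hkey hN
  · have hk : (k : ℕ) < 3 := k.isLt
    simp only [hk, dif_pos]
    exact hbS k

end Summit.HubbardSuperconductivity.HubbardSuperconductivity.Theorems.KLRegimeSplit

end
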